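import Summits.ResolutionOfSingularities.ResolutionOfSingularities.Theorems.RegularCurveFrame
import HarnessLib

/-!
# RegularCurveLaw — tree file 4/6: §11 (NEW · KERNEL) along a CORE branch: the REGULAR-CURVE LAW (`curveLaw3`
and its frame bookkeeping
along the purity-valve game at marking 3).  PROVED.

Content VERBATIM from the decomp-res lens-6 g17 file
`HOME/decomp-res-lens-6/g17/parts/RegularCurveLaw-REV1-5548be76.lean` (sha256 5548be7624d15d37;
CRITIC-LEDGER row 128; critic landing order 2026-08-30T18:16:59Z).  Its §0–§8 are g16 `AbsoluteGiraud.lean`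
@bc25b587 byte-identical and ALREADY in
the tree as `Theorems/AbsoluteContact{Scope,Primitives,HasseRing,Hasse,Axes}` + `AbsoluteGiraud{Kernel,Branch}`;
only §9–§13 are landed here — §11–§13 in the text of the lens's rev 2 TREE-SYNC pin
`parts/RegularCurveLaw-REV2-fe4ab852.lean`
(code byte-identical to rev 1; five docstrings sharpened for the critic's hygiene asks h1/h2/h4, STATUS 18:31:35Z).
HOME = run/shared/lean/pub/decomp-res.  Host: route `MaxContactCut`, asides AGHypHug3Insep 27753 / AGAbsContactOff3
27752 / AGAllHug3Off3 27751
(refining 31574 `PVPureGame`).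

[WRITER NOTE (decomp-res writer g6): the critic asked for Literature/…/Resolution placement of the scheme-level
kernels §9/§10; they land
Summits-side because the Literature gate accepts only [cite:]-tagged PUBLISHED statements (same ruling as `CouplingCutCoupled` /
`AbsoluteGiraudKernel`).  ONE namespace `…Theorems.AbsoluteContactClasses` as in the lens; global `set_option`
lines dropped (scoped
`set_option maxHeartbeats … in` kept); nothing else changed.]
(Sources: Giraud1975; EncinasVillamayor2000 Thm. 4.9; BravoGarciaEscamillaVillamayor2012 Lemma 4.6;
VillamayorU2008ReesDiff §4; CossartPiltant2008 §2; CossartJannsenSaito2020 §2–§3; EGAIV4 §16–§17;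
Matsumura1986 §14–§17.)
-/

noncomputable section

open CategoryTheory AlgebraicGeometry TopologicalSpace
open Literature.AlgebraicGeometry.Resolution
open Summit.ResolutionOfSingularities.ResolutionOfSingularities.Theorems
open WeakOrderReduction ForcedTowerClasses PurityValveClasses
open SatelliteExitClasses
open IsLocalRing MvPolynomial

namespace Summit.ResolutionOfSingularities.ResolutionOfSingularities.Theorems.AbsoluteContactClasses

/-! ## §11 (g17 · NEW · KERNEL) Along a CORE branch: the REGULAR-CURVE LAW -/

section CurveLawKernel

variable {k : Type} [Field k]

/-- **Stage link** at the point `x` of stage `i` (phrased at a variable point so that it transports along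
`π (pt (i+1)) = pt i`): every member of `𝓘_i` of exact `H`-depth `(c, ν)`, `c < 3`, `ν ≥ 3 - c`, hands a member of
`𝓘_{i+1}` to the next stage, of exact depth `(c, ν')` for the strict transform of `H`, with `ν' ≤ ν` always and
`ν' = ν − (3 − c)` at a POINT round. DEFINITION (support). -/
def StageLink (B : Branch k) (i : ℕ) (H : (B.St i).IdealSheafData) (x : B.St i) : Prop :=
  ∀ (c ν : ℕ) (f : (B.St i).presheaf.stalk x), c < 3 → 3 - c ≤ ν → f ∈ stalkIdeal (B.D i).ideal x →
    f ∈ depthIdeal (stalkIdeal H x) c ν → f ∉ depthIdeal (stalkIdeal H x) c (ν + 1) →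
    ∃ f' ∈ stalkIdeal (B.D (i + 1)).ideal (B.pt (i + 1)), ∃ ν' : ℕ, ν' ≤ ν ∧
      f' ∈ depthIdeal (stalkIdeal (strictTransformIdeal (B.π i) (B.centre i) H) (B.pt (i + 1))) c ν' ∧
      f' ∉ depthIdeal (stalkIdeal (strictTransformIdeal (B.π i) (B.centre i) H) (B.pt (i + 1))) c (ν' + 1) ∧
      (((B.centre i).support : Set (B.St i)) = {x} → ν' + (3 - c) = ν)

/-- **One blow-up of a core branch that stays on the strict transform of a regular curve germ** preserves the curve
frame and links the exact depths (point round: `curveFrame_point`; foreign round: `curveFrame_foreign`). (Sources: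
StacksProject, Tag 0BIQ; Matsumura1987, Thm. 14.2.) -/
theorem curveFrame_succ (B : Branch k) (i r : ℕ) (H : (B.St i).IdealSheafData) (hmult : (B.D i).mult = 3)
    (hci : IsCorePt (B.str i) (B.base i).isRegular (B.D i).ideal 3 (B.pt i))
    (hon : B.pt (i + 1) ∈ ((strictTransformIdeal (B.π i) (B.centre i) H).support : Set (B.St (i + 1))))
    (h : CurveFrame H r (B.pt i)) :
    CurveFrame (strictTransformIdeal (B.π i) (B.centre i) H) r (B.pt (i + 1)) ∧ StageLink B i H (B.pt i) := by
  haveI := isLocallyNoetherian_St B i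
  haveI := isLocallyNoetherian_St B (i + 1)
  have hπ := B.isBlowup i
  have hy : (B.π i).base (B.pt (i + 1)) = B.pt i := B.pt_map i
  have hDi1 : (B.D (i + 1)).ideal = controlledTransform (B.π i) (B.centre i) (B.D i).ideal 3 := by
    rw [B.transform_eq i, MarkedIdeal.transform_ideal, hmult]
  suffices hs : CurveFrame (strictTransformIdeal (B.π i) (B.centre i) H) r (B.pt (i + 1)) ∧
      StageLink B i H ((B.π i).base (B.pt (i + 1))) by rw [hy] at hs; exact hs
  have h' : CurveFrame H r ((B.π i).base (B.pt (i + 1))) := by rw [hy]; exact h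
  have hI3 : stalkIdeal (B.D i).ideal ((B.π i).base (B.pt (i + 1))) ≤ maximalIdeal _ ^ 3 := by
    rw [hy]; exact (le_idealOrder_iff _ _ 3).mp hci.1.ge
  rcases B.kind i with hpt | hfor
  · -- point round
    haveI : IsRegularLocalRing ((B.St i).presheaf.stalk ((B.π i).base (B.pt (i + 1)))) := (B.base i).isRegular _
    have hpt' : ((B.centre i).support : Set (B.St i)) = {(B.π i).base (B.pt (i + 1))} := by rw [hy]; exact hpt
    have hcl : IsClosed ({(B.π i).base (B.pt (i + 1))} : Set (B.St i)) := by rw [hy]; exact B.isClosed_pt i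
    have hCst : stalkIdeal (B.centre i) ((B.π i).base (B.pt (i + 1))) = maximalIdeal _ := by
      rw [eq_vanishingIdeal_support_of_isRegular (B.centre i) (B.centre_regular i)]
      apply stalkIdeal_vanishingIdeal_eq_maximalIdeal_of_closure_eq
      rw [hpt', hcl.closure_eq]
    obtain ⟨hF, hdrop⟩ := curveFrame_point hπ (B.pt (i + 1)) hCst H r hon h' (B.D i).ideal 3 hI3
    refine ⟨hF, fun c ν f hcb hν hfI hfQ hfnQ => ?_⟩
    obtain ⟨f', hf'I, hf'Q, hf'nQ⟩ := hdrop c ν f hcb hν hfI hfQ hfnQ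
    refine ⟨f', by rw [hDi1]; exact hf'I, ν - (3 - c), by omega, hf'Q, hf'nQ, fun _ => by omega⟩
  · -- foreign round
    have hfor' : (B.π i).base (B.pt (i + 1)) ∉ ((B.centre i).support : Set (B.St i)) := by rw [hy]; exact hfor
    obtain ⟨hF, hkeep⟩ := curveFrame_foreign hπ (B.pt (i + 1)) H r hfor' h' (B.D i).ideal 3
    refine ⟨hF, fun c ν f hcb hν hfI hfQ hfnQ => ?_⟩
    obtain ⟨f', hf'I, hf'Q, hf'nQ⟩ := hkeep c ν f hfI hfQ hfnQ
    refine ⟨f', by rw [hDi1]; exact hf'I, ν, le_rfl, hf'Q, hf'nQ, fun hc => ?_⟩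
    exact absurd (hc ▸ Set.mem_singleton _ : (B.π i).base (B.pt (i + 1)) ∈ ((B.centre i).support : Set _)) hfor'

variable (B : Branch k) (hD : IsDatum 3 (B.D 0)) (hcore : B.Core) (m r : ℕ) (H : (B.St m).IdealSheafData)
  (hhug : ∀ j, B.pt (m + j) ∈ ((strictIter B m H j).support : Set (B.St (m + j))))
  (h0 : CurveFrame H r (B.pt m))

include hD hcore hhug h0 in
/-- **KERNEL: the curve frame at every later stage** of a core branch following the strict transforms of `V(H)`.
(Sources: StacksProject, Tag 0BIQ.) -/
theorem curveFrame_strictIter : ∀ j, CurveFrame (strictIter B m H j) r (B.pt (m + j))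
  | 0 => h0
  | j + 1 => (curveFrame_succ B (m + j) r (strictIter B m H j) (mult_eq_of_isDatum B hD (m + j)) (hcore (m + j))
      (hhug (j + 1)) (curveFrame_strictIter j)).1

/-- **Exact depth `(c, ν)` is attained** by some member of `𝓘_{m+j}` w.r.t. the `j`-th strict transform of `H`.
DEFINITION (support). -/
def ExDepth (j c ν : ℕ) : Prop :=
  ∃ f ∈ stalkIdeal (B.D (m + j)).ideal (B.pt (m + j)),
    f ∈ depthIdeal (stalkIdeal (strictIter B m H j) (B.pt (m + j))) c ν ∧
    f ∉ depthIdeal (stalkIdeal (strictIter B m H j) (B.pt (m + j))) c (ν + 1)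

include hD hcore hhug h0 in
/-- **CORE LAW**: an exact depth `(c, ν)` with `c < 3` has `ν ≥ 3 − c` (`𝓘 ⊆ 𝔪³` at a core point and
`𝔪^b ∩ P^c ⊆ Q^c_{b-c}`). [folklore] -/
theorem exDepth_ge (j : ℕ) {c ν : ℕ} (hcb : c < 3) (h : ExDepth B m H j c ν) : 3 - c ≤ ν := by
  obtain ⟨f, hfI, hfQ, hfnQ⟩ := h
  obtain ⟨w, hw, hHw, hdim⟩ := curveFrame_strictIter B hD hcore m r H hhug h0 j
  obtain ⟨s, hsw, hfull⟩ := exists_transversal hw hdim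
  rw [hHw] at hfQ hfnQ
  have hfm : f ∈ maximalIdeal _ ^ 3 := (le_idealOrder_iff _ _ 3).mp (hcore (m + j)).1.ge hfI
  have hfP : f ∈ Ideal.span (Set.range w) ^ c := depthIdeal_le_pow _ c ν hfQ
  have h1 := mem_depthIdeal_of_mem_pow hsw hfull hcb hfm hfP
  by_contra hlt
  exact hfnQ (depthIdeal_antitone _ c (by omega) h1)

include hD hcore hhug h0 in
/-- **ONE STEP**: exact depth `(c, ν)` at stage `m + j` hands an exact depth `(c, ν') `, `ν' ≤ ν`, to stage `m + j + 1`,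
with `ν' = ν − (3 − c)` at a point round. [folklore] -/
theorem exDepth_step (j : ℕ) {c ν : ℕ} (hcb : c < 3) (h : ExDepth B m H j c ν) :
    ∃ ν', ν' ≤ ν ∧ ExDepth B m H (j + 1) c ν' ∧
      (((B.centre (m + j)).support : Set (B.St (m + j))) = {B.pt (m + j)} → ν' + (3 - c) = ν) := by
  have hge := exDepth_ge B hD hcore m r H hhug h0 j hcb h
  obtain ⟨f, hfI, hfQ, hfnQ⟩ := h
  obtain ⟨-, hlink⟩ := curveFrame_succ B (m + j) r (strictIter B m H j) (mult_eq_of_isDatum B hD (m + j))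
    (hcore (m + j)) (hhug (j + 1)) (curveFrame_strictIter B hD hcore m r H hhug h0 j)
  obtain ⟨f', hf'I, ν', hν', hf'Q, hf'nQ, hpt⟩ := hlink c ν f hcb hge hfI hfQ hfnQ
  exact ⟨ν', hν', ⟨f', hf'I, hf'Q, hf'nQ⟩, hpt⟩

include hD hcore hhug h0 in
/-- **TRANSPORT** over `d` further stages. [folklore] -/
theorem exDepth_transport (j d : ℕ) {c ν : ℕ} (hcb : c < 3) (h : ExDepth B m H j c ν) :
    ∃ ν', ν' ≤ ν ∧ ExDepth B m H (j + d) c ν' := by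
  induction d with
  | zero => exact ⟨ν, le_rfl, h⟩
  | succ d ih =>
    obtain ⟨ν₁, hν₁, h₁⟩ := ih
    obtain ⟨ν₂, hν₂, h₂, -⟩ := exDepth_step B hD hcore m r H hhug h0 (j + d) hcb h₁
    exact ⟨ν₂, hν₂.trans hν₁, h₂⟩

include hD hcore hhug h0 in
/-- **INFINITE DESCENT**: the point rounds recur for ever (`Branch.io`) and each costs `3 − c ≥ 1` units of depth, so
an exact finite depth is impossible: `N ≤ ν` for every `N`. [folklore] -/
theorem exDepth_unbounded {c : ℕ} (hcb : c < 3) : ∀ N j ν, ExDepth B m H j c ν → N ≤ ν := by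
  intro N
  induction N with
  | zero => intros; exact Nat.zero_le _
  | succ N ih =>
    intro j ν h
    obtain ⟨i₁, hi₁, hpt⟩ := B.io (m + j)
    obtain ⟨d, hd⟩ := Nat.exists_eq_add_of_le hi₁
    obtain ⟨ν₁, hν₁, h₁⟩ := exDepth_transport B hD hcore m r H hhug h0 j d hcb h
    have hpt' : ((B.centre (m + (j + d))).support : Set (B.St (m + (j + d)))) = {B.pt (m + (j + d))} := by
      rw [← Nat.add_assoc, ← hd]; exact hpt
    obtain ⟨ν₂, hν₂, h₂, hdrop⟩ := exDepth_step B hD hcore m r H hhug h0 (j + d) hcb h₁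
    have hge := exDepth_ge B hD hcore m r H hhug h0 (j + d) hcb h₁
    have h3 := ih (j + d + 1) ν₂ h₂
    have h4 := hdrop hpt'
    omega

include hD hcore hhug h0 in
/-- **MAIN LOCAL THEOREM (the curve law, one exponent at a time)**: `𝓘_{m+j} ∩ P^c ⊆ P^{c+1}` for `c < 3`,
`P` the stalk of the `j`-th strict transform of `H` at the followed point. [folklore] -/
theorem mem_pow_succ_of_mem_pow (j c : ℕ) (hcb : c < 3) {f : (B.St (m + j)).presheaf.stalk (B.pt (m + j))}
    (hfI : f ∈ stalkIdeal (B.D (m + j)).ideal (B.pt (m + j)))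
    (hfP : f ∈ stalkIdeal (strictIter B m H j) (B.pt (m + j)) ^ c) :
    f ∈ stalkIdeal (strictIter B m H j) (B.pt (m + j)) ^ (c + 1) := by
  classical
  haveI := isLocallyNoetherian_St B (m + j)
  apply mem_pow_succ_of_forall_mem_depthIdeal
  intro ν
  by_contra hν
  have hex : ∃ μ, f ∉ depthIdeal (stalkIdeal (strictIter B m H j) (B.pt (m + j))) c (μ + 1) := by
    rcases ν with _ | μ
    · exact absurd (by rw [depthIdeal_zero]; exact hfP) hν
    · exact ⟨μ, hν⟩
  set μ := Nat.find hex with hμdef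
  have hμ : f ∉ depthIdeal (stalkIdeal (strictIter B m H j) (B.pt (m + j))) c (μ + 1) := Nat.find_spec hex
  have hμ' : f ∈ depthIdeal (stalkIdeal (strictIter B m H j) (B.pt (m + j))) c μ := by
    rcases Nat.eq_zero_or_pos μ with h0 | hpos
    · rw [h0, depthIdeal_zero]; exact hfP
    · obtain ⟨μ₀, hμ₀⟩ := Nat.exists_eq_add_of_lt hpos
      rw [hμ₀, Nat.zero_add]
      by_contra hnot
      exact Nat.find_min hex (show μ₀ < μ by omega) hnot
  have := exDepth_unbounded B hD hcore m r H hhug h0 hcb (μ + 1) j μ ⟨f, hfI, hμ', hμ⟩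
  omega

include hD hcore hhug h0 in
/-- **THE CURVE LAW (local form)**: `𝓘_{m+j} ⊆ P_j³` — the hugged regular curve germ lies in the top locus
at every stage.
Nearest printed statement: Cossart–Jannsen–Saito, LNM 2270, p. 139–140, the deduction «Theorem 10.2 ⇒
Theorem 6.35»: an
INFINITE fundamental sequence over `x` forces `δ_{L_q} ≥ q + 1` for all `q`, hence `v_𝔮(f_i) = n_i = v_𝔪(f_i)` for
`𝔮 = ⟨y, u_2, …, u_s⟩` — equimultiplicity along the regular `D = V(𝔮)` — there for the
Hilbert–Samuel stratum, `D` cut out by the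
directrix data, and under `char k(x) = 0 ∨ char k(x) ≥ dim X/2 + 1`; here for the order-`3` stratum, ANY hugged
regular curve germ,
no characteristic hypothesis (surface shadow: Kollár, Thm. 1.81). (Sources: CossartJannsenSaito2020, Thm. 10.2,
Thm. 6.35, p. 139-140; Kollar2007, Thm. 1.81.) -/
theorem stalkIdeal_le_cube (j : ℕ) :
    stalkIdeal (B.D (m + j)).ideal (B.pt (m + j)) ≤ stalkIdeal (strictIter B m H j) (B.pt (m + j)) ^ 3 := by
  intro f hf
  have hf0 : f ∈ stalkIdeal (strictIter B m H j) (B.pt (m + j)) ^ 0 := by rw [pow_zero, Ideal.one_eq_top]; trivial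
  have h1 := mem_pow_succ_of_mem_pow B hD hcore m r H hhug h0 j 0 (by norm_num) hf hf0
  have h2 := mem_pow_succ_of_mem_pow B hD hcore m r H hhug h0 j 1 (by norm_num) hf h1
  exact mem_pow_succ_of_mem_pow B hD hcore m r H hhug h0 j 2 (by norm_num) hf h2

omit hD hcore hhug h0

/-- The stalks of the iterated strict transforms at the followed points only depend on the stalk at `pt m`. [folklore] -/
theorem stalkIdeal_strictIter_congr (H H' : (B.St m).IdealSheafData) (hst : stalkIdeal H (B.pt m) = stalkIdeal H' (B.pt m)) :
    ∀ j, stalkIdeal (strictIter B m H j) (B.pt (m + j)) = stalkIdeal (strictIter B m H' j) (B.pt (m + j))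
  | 0 => hst
  | j + 1 => by
    haveI := isLocallyNoetherian_St B (m + j)
    haveI := isLocallyNoetherian_St B (m + j + 1)
    have hy : (B.π (m + j)).base (B.pt (m + j + 1)) = B.pt (m + j) := B.pt_map (m + j)
    have ih : stalkIdeal (strictIter B m H j) ((B.π (m + j)).base (B.pt (m + j + 1))) =
        stalkIdeal (strictIter B m H' j) ((B.π (m + j)).base (B.pt (m + j + 1))) := by
      rw [hy]; exact stalkIdeal_strictIter_congr H H' hst j
    show stalkIdeal (strictTransformIdeal (B.π (m + j)) (B.centre (m + j)) (strictIter B m H j)) (B.pt (m + j + 1)) =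
      stalkIdeal (strictTransformIdeal (B.π (m + j)) (B.centre (m + j)) (strictIter B m H' j)) (B.pt (m + j + 1))
    rw [stalkIdeal_strictTransformIdeal, stalkIdeal_strictTransformIdeal, ih]

/-- **`B.HugsRegCurve`** — from some stage `m` on, the branch follows for ever the strict transforms of a REGULAR CURVE
GERM `V(H) ∋ pt m` (`H_{pt m} = (w_1, …, w_{d-1})`, `w` part of a regular system of parameters, `d = dim 𝒪_{pt m}`).
DEFINITION (support). -/
def _root_.Summit.ResolutionOfSingularities.ResolutionOfSingularities.Theorems.SatelliteExitClasses.Branch.HugsRegCurve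
    (B : Branch k) : Prop :=
  ∃ (m r : ℕ) (H : (B.St m).IdealSheafData), CurveFrame H r (B.pt m) ∧ HugsGerm B m H

/-- stalk `⊥` means order `⊤`. [folklore] -/
theorem idealOrder_eq_top_of_stalkIdeal_eq_bot' {Y : Scheme.{0}} (I : Y.IdealSheafData) (y : Y)
    (h : stalkIdeal I y = ⊥) : idealOrder I y = ⊤ :=
  ENat.eq_top_iff_forall_ge.mpr fun n => (le_idealOrder_iff I y n).mpr (by rw [h]; exact bot_le)

/-- **THEOREM (g17 · THE REGULAR-CURVE LAW): a CORE branch that hugs a regular curve germ HUGS A TOP CURVE** — the hugged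
germ lies in the top locus `Sing₃` at every stage; all characteristics, all fields, no purity / escaping / contact
hypothesis. (Sources: CossartJannsenSaito2009, Thm. 2.10; Matsumura1987, Thm. 14.2.) -/
theorem hugsTop_of_hugsRegCurve (B : Branch k) (hD : IsDatum 3 (B.D 0)) (hcore : B.Core) (hH : B.HugsRegCurve) :
    B.HugsTop := by
  classical
  obtain ⟨m, r, H, ⟨w, hw, hHw, hdim⟩, hgerm⟩ := hH
  haveI := isLocallyNoetherian_St B m
  haveI : IsRegularLocalRing ((B.St m).presheaf.stalk (B.pt m)) := (B.base m).isRegular _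
  set P : Ideal ((B.St m).presheaf.stalk (B.pt m)) := Ideal.span (Set.range w) with hPdef
  haveI hP : P.IsPrime := hw.isPrime_span_range
  -- the generic point of the curve germ and its closure
  let q : PrimeSpectrum ((B.St m).presheaf.stalk (B.pt m)) := ⟨P, hP⟩
  let η : B.St m := (B.St m).fromSpecStalk (B.pt m) q
  have hη : η ⤳ B.pt m := fromSpecStalk_specializes q
  set Hc : (B.St m).IdealSheafData := Scheme.IdealSheafData.vanishingIdeal ⟨closure {η}, isClosed_closure⟩
    with hHcdef
  have hPq : primeOfSpecializes hη = P := primeOfSpecializes_fromSpecStalk q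
  have hHc : stalkIdeal Hc (B.pt m) = P := by rw [hHcdef, stalkIdeal_vanishingIdeal_closure hη, hPq]
  -- hugging transfers from `H` to `Hc` (same stalk at `pt m`)
  have hcongr := stalkIdeal_strictIter_congr B m H Hc (hHw.trans hHc.symm)
  have hhug : ∀ j, B.pt (m + j) ∈ ((strictIter B m Hc j).support : Set (B.St (m + j))) := fun j => by
    have h1 := (mem_support_iff_stalkIdeal_le _ _).mp (hgerm.2 j)
    exact (mem_support_iff_stalkIdeal_le _ _).mpr (by rw [← hcongr j]; exact h1)
  have h0 : CurveFrame Hc r (B.pt m) := ⟨w, hw, hHc, hdim⟩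
  have hframe := curveFrame_strictIter B hD hcore m r Hc hhug h0
  have hcube : stalkIdeal (B.D m).ideal (B.pt m) ≤ P ^ 3 := by
    have h1 : stalkIdeal (B.D (m + 0)).ideal (B.pt (m + 0)) ≤ stalkIdeal (strictIter B m Hc 0) (B.pt (m + 0)) ^ 3 :=
      stalkIdeal_le_cube B hD hcore m r Hc hhug h0 0
    rw [← hHc]; exact h1
  -- `P ≠ ⊥` (else `𝓘_{pt m} = ⊥`, order `⊤ ≠ 3`)
  have hIne : stalkIdeal (B.D m).ideal (B.pt m) ≠ ⊥ := by
    intro hbot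
    have h1 := idealOrder_eq_top_of_stalkIdeal_eq_bot' _ _ hbot
    have h2 := (hcore m).1
    rw [h1] at h2
    exact ENat.top_ne_coe _ h2
  have hPne : P ≠ ⊥ := fun hP0 => hIne (le_bot_iff.mp (hcube.trans (by rw [hP0, Ideal.bot_pow (by norm_num)])))
  refine ⟨m, Hc, ⟨?_, hhug⟩, ?_, ?_⟩
  · -- finite order at `pt m`
    exact (idealOrder_lt_top_of_stalkIdeal_ne_bot (by rw [hHc]; exact hPne)).ne
  · -- GLOBAL support in the top locus: semicontinuity from the generic point `η`, where `𝓘_η ⊆ 𝔪_η³`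
    intro t ht
    have ht' : t ∈ (Scheme.IdealSheafData.vanishingIdeal ⟨closure {η}, isClosed_closure⟩ :
        (B.St m).IdealSheafData).support := by
      rw [← hHcdef]; exact ht
    have hηt : η ⤳ t := mem_support_vanishingIdeal_closure_singleton_iff.mp ht'
    haveI : IsRegularLocalRing ((B.St m).presheaf.stalk t) := (B.base m).isRegular _
    haveI : IsRegularLocalRing ((B.St m).presheaf.stalk η) := (B.base m).isRegular _
    show ((B.D m).mult : ℕ∞) ≤ idealOrder (B.D m).ideal t
    rw [mult_eq_of_isDatum B hD m]
    refine le_trans ?_ (idealOrder_le_of_specializes hηt _)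
    rw [le_idealOrder_iff, ← stalkIdeal_map_stalkSpecializes _ hη]
    have hPle : P.map ((B.St m).presheaf.stalkSpecializes hη).hom ≤ maximalIdeal _ := by
      rw [← hPq]; exact Ideal.map_comap_le
    calc (stalkIdeal (B.D m).ideal (B.pt m)).map ((B.St m).presheaf.stalkSpecializes hη).hom
        ≤ (P ^ 3).map ((B.St m).presheaf.stalkSpecializes hη).hom := Ideal.map_mono hcube
      _ = (P.map ((B.St m).presheaf.stalkSpecializes hη).hom) ^ 3 := Ideal.map_pow _ _ 3
      _ ≤ maximalIdeal _ ^ 3 := Ideal.pow_right_mono hPle 3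
  · -- the quotient by the curve prime has dimension one
    rw [hHc]
    have h1 := hw.ringKrullDim_quotient_add
    rw [hdim, Nat.add_comm] at h1
    rw [eq_of_add_natCast_eq h1, Nat.cast_one]

end CurveLawKernel

end Summit.ResolutionOfSingularities.ResolutionOfSingularities.Theorems.AbsoluteContactClasses
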